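import Mathlib
import Literature.Computability.AlgebraicComplexity.BurgisserBooleanPartsModPCircuits
import Literature.Computability.AlgebraicComplexity.SignedWordCircuits
import Summits.ValiantsHypothesis.ValiantsHypothesis.Theorems.NumTameDefs
import Summits.ValiantsHypothesis.ValiantsHypothesis.Theorems.NumTameGaussWordCircuits
import Summits.ValiantsHypothesis.ValiantsHypothesis.Theorems.NumTameFixedPointRunCircuits
import HarnessLib

/-!
# Route NumTame — registered stub `stub_gates` of crux `TameA3` (stmt-ValiantsHypothesis-5386)

STUB 2 of line `birth` (FIXED-POINT GATES, the Boolean-engineering half): for some absolute `c`,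
for EVERY fan-in-two circuit `P` over `ℂ` in `n` variables and all `I B w`, the map
`x ↦ (bit i of FixedPoint.outNat P I B x)_{i<w}` has `B₂`-circuits of size
`≤ (P.size + I + B + w + 2)^c` — no tameness hypothesis (the clamp bounds every word).

Proof: run `cktSize_fxBus` (NumTameFixedPointRunCircuits) with word width `W = 2(I+B)+4`, fetch
the output operand (`evalFx`), form `u = 2·re + 2^B` (`|u| < 2^(I+B+2) ≤ 2^(W-1)`), shift it
arithmetically by `B+1` (`HasBits.ashr`), and read `⌊·⌋⁺` off the two's complement word: bit `i`
of `Int.toNat v` is `¬(sign bit) ∧ bit i` (`testBit_toNat_eq_word`).  The gate count is a cubic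
polynomial in `W` per arithmetic gate; `c = 20` absorbs all constants
(`(P.size + 1) · 600 (W+2)^3 + w ≤ (P.size + I + B + w + 2)^20`).

Honest framing: stub credit for a conditional route (NumTame: crux `TameNF` and `NP ⊄ P/poly` stay
open); `VP ≠ VNP` is NOT proved and nothing here bears on it.

## References

* P. Bürgisser, *Cook's versus Valiant's hypothesis*, TCS 235 (2000), §5 (A3) p. 86. [cite: Burgisser2000TCS, §5 (A3)]
* H. Vollmer, *Introduction to Circuit Complexity* (1999), §1.3 (two's complement). [cite: Vollmer1999, §1.3]
-/

set_option linter.dupNamespace false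

noncomputable section

namespace Summit.ValiantsHypothesis.ValiantsHypothesis.Theorems.NumTame

open Literature.Computability.AlgebraicComplexity Literature.Computability.Complexity FixedPoint
open ArithCircuit (Operand)

/-! ### Reading `⌊·⌋⁺` off a two's complement word -/

/-- A natural number `N` with `2^(W-1) ≤ N < 2^W` has its bit `W - 1` set. [folklore] -/
theorem testBit_pred_eq_true_of_ge {W N : ℕ} (h1 : 2 ^ (W - 1) ≤ N) (h2 : N < 2 ^ W) :
    N.testBit (W - 1) = true := by
  obtain ⟨j, hj, hjb⟩ := Nat.exists_ge_and_testBit_of_ge_two_pow h1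
  by_cases hjW : j < W
  · have : j = W - 1 := by omega
    rw [← this, hjb]
  · rw [Nat.testBit_lt_two_pow (h2.trans_le (Nat.pow_le_pow_right (by norm_num) (by omega)))] at hjb
    exact absurd hjb Bool.false_ne_true

/-- **Bits of `⌊v⌋⁺` from the word of `v`**: for `|v| < 2^(W-1)` and `i < W`,
`(Int.toNat v).testBit i = ¬(sign bit of the word) ∧ (bit i of the word)`, the word being the
binary representation of `(v : ZMod (2^W)).val` (Vollmer 1999, §1.3). [cite: Vollmer1999, §1.3] -/
theorem testBit_toNat_eq_word {W : ℕ} {v : ℤ} (hv : |v| < 2 ^ (W - 1)) {i : ℕ} (hi : i < W) :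
    v.toNat.testBit i =
      (!((v : ZMod (2 ^ W))).val.testBit (W - 1) && ((v : ZMod (2 ^ W))).val.testBit i) := by
  have hW : 1 ≤ W := by omega
  have hpow : (2 : ℤ) ^ W = 2 ^ (W - 1) * 2 := by rw [← pow_succ]; congr 1; omega
  have hval : (((v : ZMod (2 ^ W))).val : ℤ) = v % 2 ^ W := by
    rw [ZMod.val_intCast]; push_cast; rfl
  rw [abs_lt] at hv
  by_cases h0 : 0 ≤ v
  · -- nonnegative: the word is `v` itself, sign bit clear
    have hvn : ((v : ZMod (2 ^ W))).val = v.toNat := by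
      apply Int.ofNat.inj
      simp only [Int.ofNat_eq_natCast]
      rw [hval, Int.toNat_of_nonneg h0, Int.emod_eq_of_lt h0 (by linarith)]
    have hlt : v.toNat < 2 ^ (W - 1) := by
      have : (v.toNat : ℤ) < 2 ^ (W - 1) := by rw [Int.toNat_of_nonneg h0]; exact hv.2
      exact_mod_cast this
    rw [hvn, Nat.testBit_lt_two_pow hlt]
    simp
  · -- negative: `⌊v⌋⁺ = 0`, the word is `v + 2^W ≥ 2^(W-1)`, sign bit set
    push Not at h0
    have ht : v.toNat = 0 := Int.toNat_eq_zero.2 h0.le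
    have hvn : (((v : ZMod (2 ^ W))).val : ℤ) = v + 2 ^ W := by
      rw [hval, Int.emod_eq_add_self_emod, Int.emod_eq_of_lt (by linarith) (by linarith)]
    have hge : 2 ^ (W - 1) ≤ ((v : ZMod (2 ^ W))).val := by
      have : (2 : ℤ) ^ (W - 1) ≤ (((v : ZMod (2 ^ W))).val : ℤ) := by rw [hvn]; linarith
      exact_mod_cast this
    have hltW : ((v : ZMod (2 ^ W))).val < 2 ^ W := by
      have := ZMod.val_lt (v : ZMod (2 ^ W)); simpa using this
    rw [ht, Nat.zero_testBit, testBit_pred_eq_true_of_ge hge hltW]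
    simp

/-! ### The output stage -/

section Output

variable {n : ℕ} {I B W : ℕ}

/-- **The rounded output as bits**: on the bus after all gates of `P`, the row
`i ↦ (outNat P I B x).testBit i` (`i < w`) costs `≤ 12 W + 4·modAddCost W + 3 + w` gates
(fetch the output word, `u = 2·re + 2^B`, arithmetic shift by `B + 1`, sign-masked read-out). [cite: Burgisser2000TCS, §5 (A3)] -/
theorem cktSizeVia_outNat_bits (hW : 2 * (I + B) + 4 ≤ W) (P : ArithCircuit ℂ (Fin n)) (w : ℕ) :
    CktSizeVia (fun x : Fin n → Bool => fxBus W x (gateValuesFx I B x P.gates) P.gates.length)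
      (fun x (i : Fin w) => (outNat P I B x).testBit i)
      (6 * W + 6 * W + W * 1 + modAddCost W + modAddCost W +
        (W * 1 + modAddCost W + 1 + W * 1 + modAddCost W) + w * 1) := by
  have hle : 2 ^ W ≤ 2 ^ W := le_rfl
  set e := fun x : Fin n → Bool => fxBus W x (gateValuesFx I B x P.gates) P.gates.length with he
  -- the output word and its magnitude
  have hev : CktSizeVia e (fun x => gaussBits W (evalFx P I B x)) (6 * W) :=
    cktSizeVia_operandFx I B W P.gates P.output
  set y : (Fin n → Bool) → ℤ := fun x => (evalFx P I B x).re with hy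
  have hyb : ∀ x, |y x| < 2 ^ (I + B) := fun x =>
    (abs_operandFx_lt I B x _ (fun z hz => abs_lt_of_mem_gateValuesFx I B x P.gates z hz) P.output).1
  have hre : HasBits W e (fun x => ((y x : ℤ) : ZMod (2 ^ W))) (6 * W) := hasBits_re_of_gauss hev
  -- `u = 2 y + 2^B`
  have hu : HasBits W e (fun x => ((2 * y x + 2 ^ B : ℤ) : ZMod (2 ^ W)))
      (6 * W + 6 * W + modAddCost W + W * 1 + modAddCost W) :=
    ((hre.add hle hre).add hle (HasBits.const W e (((2 ^ B : ℕ) : ℤ) : ZMod (2 ^ W)))).congr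
      fun x => by push_cast; ring
  have hub : ∀ x, |2 * y x + 2 ^ B| < 2 ^ (W - 1) := fun x => by
    have h1 := hyb x
    rw [abs_lt] at h1 ⊢
    have h2 : (2 : ℤ) ^ B ≤ 2 ^ (I + B) := pow_le_pow_right₀ (by norm_num) (by omega)
    have h3 : (2 : ℤ) ^ (I + B) * 4 ≤ 2 ^ (W - 1) := by
      rw [show (4 : ℤ) = 2 ^ 2 by norm_num, ← pow_add]
      exact pow_le_pow_right₀ (by norm_num) (by omega)
    have h4 : (0 : ℤ) < 2 ^ B := by positivity
    have h5 : (0 : ℤ) ≤ 2 ^ (I + B) := by positivity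
    constructor <;> linarith
  -- `v = ⌊u / 2^(B+1)⌋`
  have hv := hu.ashr (B := B + 1) (by omega) hub
  have hvb : ∀ x, |(2 * y x + 2 ^ B) / 2 ^ (B + 1)| < 2 ^ (W - 1) := fun x =>
    (Int.abs_ediv_le_abs _ _).trans_lt (hub x)
  -- read-out row
  set f : (Fin n → Bool) → Fin W → Bool :=
    fun x => testBits W ((((2 * y x + 2 ^ B) / 2 ^ (B + 1) : ℤ) : ZMod (2 ^ W))).val with hf
  have hv' : CktSizeVia e f _ := hv
  have hW1 : 1 ≤ W := by omega
  have hrow : CktSizeVia f (fun x (i : Fin w) => (outNat P I B x).testBit i) (Fintype.card (Fin w) * 1) := by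
    refine CktSizeVia.pi_const (κ := Fin w) (e := f) (s := 1) fun i => ?_
    by_cases hi : (i : ℕ) < W
    · refine (CktSizeVia.binop f (fun a b => !a && b) ⟨W - 1, by omega⟩ ⟨i, hi⟩).congr fun x => ?_
      funext u
      simp only [hf, testBits_apply, outNat, hy]
      rw [testBit_toNat_eq_word (hvb x) hi]
    · refine (CktSizeVia.of_cktSize (cktSize_const (Fin W) false) fun x => ?_)
      funext u
      have hlt : outNat P I B x < 2 ^ (i : ℕ) := by
        have h1 : ((outNat P I B x : ℕ) : ℤ) ≤ |(2 * y x + 2 ^ B) / 2 ^ (B + 1)| := by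
          simp only [outNat, hy]
          set v : ℤ := (2 * (evalFx P I B x).re + 2 ^ B) / 2 ^ (B + 1) with hvdef
          rcases le_or_gt 0 v with h | h
          · rw [Int.toNat_of_nonneg h]; exact le_abs_self v
          · rw [Int.toNat_eq_zero.2 h.le]; simp [abs_nonneg]
        have h2 : |(2 * y x + 2 ^ B) / 2 ^ (B + 1)| < 2 ^ (i : ℕ) :=
          (hvb x).trans_le (pow_le_pow_right₀ (by norm_num) (by omega))
        exact_mod_cast h1.trans_lt h2
      exact (Nat.testBit_lt_two_pow hlt).symm
  refine ((hv'.trans hrow).of_le (le_of_eq ?_))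
  simp only [Fintype.card_fin]
  ring

/-- **All of stub 2 at a fixed word width**: for `W = 2(I+B)+4` and a fan-in-two `P`, the bits of
`outNat P I B x` are a `B₂`-circuit of size
`P.size · (12·modMulCost W + 22·modAddCost W + 62 W + 32) + (15 W + 4·modAddCost W + 1 + w)`. [cite: Burgisser2000TCS, §5 (A3)] -/
theorem cktSize_outNat_bits (P : ArithCircuit ℂ (Fin n)) (hP : P.IsFanInTwo) (I B w : ℕ) :
    CktSize B2 (fun (x : Fin n → Bool) (i : Fin w) => (outNat P I B x).testBit i)
      (P.size * (12 * modMulCost (2 * (I + B) + 4) + 22 * modAddCost (2 * (I + B) + 4) +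
          62 * (2 * (I + B) + 4) + 32) +
        (15 * (2 * (I + B) + 4) + 4 * modAddCost (2 * (I + B) + 4) + 1 + w)) := by
  set W := 2 * (I + B) + 4 with hWdef
  have hW : 2 * (I + B) + 4 ≤ W := le_rfl
  have h1 := cktSize_fxBus (I := I) (B := B) hW P.gates hP
  have h2 := (CktSizeVia.of_cktSize_id h1).trans (cktSizeVia_outNat_bits hW P w)
  refine h2.toCktSize.of_le (le_of_eq ?_)
  simp only [ArithCircuit.size]
  ring

end Output

/-! ### Polynomial bookkeeping and the registered stub -/

/-- `modMulCost W ≤ 21 (W + 2)^3`. [folklore] -/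
theorem modMulCost_le (W : ℕ) : modMulCost W ≤ 21 * (W + 2) ^ 3 := by
  simp only [modMulCost, modMulStepCost, modAddCost]
  nlinarith [Nat.zero_le W, sq_nonneg (W + 2)]

/-- The per-gate and output gate counts are `≤ 600 (W+2)^3` resp. `≤ 60 (W+2)^3 + w`. [folklore] -/
theorem gateCostFx_le (W : ℕ) :
    12 * modMulCost W + 22 * modAddCost W + 62 * W + 32 ≤ 600 * (W + 2) ^ 3 ∧
      15 * W + 4 * modAddCost W + 1 ≤ 60 * (W + 2) ^ 3 := by
  have h := modMulCost_le W
  simp only [modAddCost]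
  constructor <;> nlinarith [Nat.zero_le W]

/-- **Registered stub `stub_gates` of crux `TameA3` (line `birth`), verbatim**: polynomial-size
`B₂`-circuits for the bits of the clamped fixed-point run's rounded output, for EVERY fan-in-two
circuit (no tameness hypothesis), with the absolute exponent `c = 20`. [cite: Burgisser2000TCS, §5 (A3)] -/
theorem stub_gates :
    ∃ c : ℕ, ∀ (n I B w : ℕ) (P : ArithCircuit ℂ (Fin n)), P.IsFanInTwo →
      CktSize B2 (fun (x : Fin n → Bool) (i : Fin w) => (FixedPoint.outNat P I B x).testBit i)
        ((P.size + I + B + w + 2) ^ c) := by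
  refine ⟨20, fun n I B w P hP => (cktSize_outNat_bits P hP I B w).of_le ?_⟩
  set W := 2 * (I + B) + 4 with hW
  set N := P.size + I + B + w + 2 with hN
  obtain ⟨hg, ho⟩ := gateCostFx_le W
  have hW2 : W + 2 ≤ 3 * N := by omega
  have hcube : (W + 2) ^ 3 ≤ 27 * N ^ 3 := by
    calc (W + 2) ^ 3 ≤ (3 * N) ^ 3 := Nat.pow_le_pow_left hW2 3
      _ = 27 * N ^ 3 := by ring
  have hs : P.size + 1 ≤ N := by omega
  have hw : w ≤ N := by omega
  have hN2 : 2 ≤ N := by omega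
  have h16 : 2 ^ 16 ≤ N ^ 16 := Nat.pow_le_pow_left hN2 16
  calc P.size * (12 * modMulCost W + 22 * modAddCost W + 62 * W + 32) +
        (15 * W + 4 * modAddCost W + 1 + w)
      ≤ P.size * (600 * (W + 2) ^ 3) + (60 * (W + 2) ^ 3 + w) :=
        add_le_add (Nat.mul_le_mul_left _ hg) (Nat.add_le_add_right ho _)
    _ ≤ (P.size + 1) * (600 * (W + 2) ^ 3) + w := by nlinarith
    _ ≤ N * (600 * (27 * N ^ 3)) + N := by gcongr
    _ = 16200 * N ^ 4 + N := by ring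
    _ ≤ 16201 * N ^ 4 := by nlinarith [Nat.le_self_pow (show (4 : ℕ) ≠ 0 by norm_num) N]
    _ ≤ N ^ 4 * N ^ 16 := by nlinarith [Nat.zero_le (N ^ 4)]
    _ = N ^ 20 := by rw [← pow_add]

end Summit.ValiantsHypothesis.ValiantsHypothesis.Theorems.NumTame

end
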